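import Summits.QuantumAdvantage.AdviceFreeQNC0.ApMaj3Triple
import Summits.QuantumAdvantage.AdviceFreeQNC0.HardcoreCylinder
import HarnessLib

/-!
# Cell qa-qnc0 — far dictators: the sharp `1/2` from the two law-of-`J` lemmas (planner qa-qnc0-p1 g19,
ROUND-18 §4; `exp19/Sketch19.lean` §5, definitions VERBATIM)

The far-dictator strategy with offset `h` stakes `b_j = x_{j+h}` (output `z_j = t_j(x) ⊕ x_{j+h}`).  At `θ < 1` it
is already covered by `affineStakesHardOdd3` (an affine stake of row weight `1`); the planner's SHARP rung
`FarDictatorHalf3` (limit value `1/2`) is reduced here to the two law-of-`J` lemmas `RareNoParticlePairAtDist`,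
`RareShiftClosedParticles` (typed §5 targets, NOT proved here): **`farDictatorHalf3_of`**.

Proof (ROUND-18 §4, over the kernel fibration): on the fibre `{x odd : J(x) = v}` the win bit is
`Σ_i v_{i-h} x_i = c(v) ⊕ ⊕_{i ∈ S(v)} x_i` with the COIN set `S(v) = {i : v_i = 0, v_{i-h} = 1}` (the bits on
`supp v` are forced, `apply_eq_of_kline`); by `card_fibre_coinParity` it is balanced on the fibre unless
`S(v) = ∅` (the particle set is `−h`-, hence `+h`-closed) or `S(v) =` all particles (no two particles at
distance `h`); summing over fibres, `2·#WIN ≤ 2^{n−1} + 2·#E₁ + 2·#E₂`.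

WHAT THIS IS NOT: the law-of-`J` lemmas are hypotheses; crux 22907 untouched; separation NOT moved.
-/

noncomputable section

namespace Summit.QuantumAdvantage.AdviceFreeQNC0.Fib19

open Finset Literature.Computability.QuantumComplexity Literature.Computability.QuantumComplexity.RingHLF
open Fin.CommRing

variable {n : ℕ}

/-! ### §5 statements (Sketch19 §5, verbatim) -/

/-- The far-dictator strategy with offset `h`: output `z_j = t_j(x) ⊕ x_{j+h}`, i.e. STAKE `b_j = x_{j+h}`
(every output bit has `𝔽₃`-degree `≤ 3`: a parity of three input bits). -/
def farDictator (h : ℕ) (x : Fin n → Bool) : Fin n → Bool := fun j => xor (tGuess x j) (x (shift h j))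

/-- **RUNG `FarDictatorHalf3`** (ROUND-18 §4): for every `ε > 0`, all large `n` and every offset `2 ≤ h ≤ n - 2`,
the far-dictator strategy satisfies the ring relation on at most `(1/2 + ε)·2^{n-1}` odd patterns.
(Sketch19 §5, verbatim.) -/
def FarDictatorHalf3 : Prop :=
  open scoped Classical in
  ∀ ε : ℝ, 0 < ε → ∃ n₀ : ℕ, ∀ n ≥ n₀, ∀ h : ℕ, 2 ≤ h → h + 2 ≤ n →
    ((univ.filter fun x : Fin n → Bool => OddZeros x ∧ Rel x (farDictator h x)).card : ℝ)
      ≤ (1 / 2 + ε) * (2 : ℝ) ^ (n - 1)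

/-- Law-of-J lemma (i) (Sketch19 §5 target, verbatim; NOT proved here): for every offset `2 ≤ h ≤ n-2`, all
but an `ε`-fraction of odd patterns have two particles at cyclic distance `h`. -/
def RareNoParticlePairAtDist : Prop :=
  open scoped Classical in
  ∀ ε : ℝ, 0 < ε → ∃ n₀ : ℕ, ∀ n ≥ n₀, ∀ h : ℕ, 2 ≤ h → h + 2 ≤ n →
    ((univ.filter fun x : Fin n → Bool => OddZeros x ∧
        ∀ p : Fin n, ¬ (kline x p = false ∧ kline x (shift h p) = false)).card : ℝ) ≤ ε * (2 : ℝ) ^ (n - 1)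

/-- Law-of-J lemma (ii) (Sketch19 §5 target, verbatim; NOT proved here): the particle set is `+h`-closed only
on an `ε`-fraction of odd patterns. -/
def RareShiftClosedParticles : Prop :=
  open scoped Classical in
  ∀ ε : ℝ, 0 < ε → ∃ n₀ : ℕ, ∀ n ≥ n₀, ∀ h : ℕ, 2 ≤ h → h + 2 ≤ n →
    ((univ.filter fun x : Fin n → Bool => OddZeros x ∧
        ∀ p : Fin n, kline x p = false → kline x (shift h p) = false).card : ℝ) ≤ ε * (2 : ℝ) ^ (n - 1)

/-! ### The win bit of the far dictator on a fibre -/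

/-- The stake of the far dictator is `x_{j+h}`. -/
theorem stake_farDictator (h : ℕ) (x : Fin n → Bool) (j : Fin n) : stake (farDictator h) x j = x (shift h j) := by
  unfold stake farDictator
  cases tGuess x j <;> cases x (shift h j) <;> rfl

/-- The coin set `S(v) = {i : v_i = 0, v_{i-h} = 1}` of a vector `v` (positions as ring elements, `H = h`). -/
def coinSet [NeZero n] (H : Fin n) (v : Fin n → Bool) : Finset (Fin n) :=
  univ.filter fun i : Fin n => v i = false ∧ v (i - H) = true

/-- The forced part `c(v) = Σ_{i : v_i = 1} v_{i-h}·(v_{i-1} ⊕ v_{i+1})` of the win bit on the fibre of `v`. -/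
def forcedBit [NeZero n] (H : Fin n) (v : Fin n → Bool) : ZMod 2 :=
  ∑ i, if v i = true then bitVal (v (i - H)) * bitVal (xor (v (prv i)) (v (nxt i))) else 0

/-- **The win bit on a fibre.** For an odd `x` with kernel line `J` (and `H = h` in the ring `Fin n`):
`WIN(x) ⟺ c(J) + #{i ∈ S(J) : x_i} ≡ 1 (mod 2)`. -/
theorem win_farDictator_iff [NeZero n] (hn : 3 ≤ n) (h : ℕ) (x : Fin n → Bool) (hodd : IsOdd x) :
    Rel x (farDictator h x) ↔
      forcedBit (h : Fin n) (kline x) +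
        (((coinSet (h : Fin n) (kline x)).filter fun i => x i = true).card : ZMod 2) = 1 := by
  set H : Fin n := (h : Fin n) with hH
  rw [rel_iff_stake hn (farDictator h) x hodd, dot2_eq_one_iff]
  simp_rw [stake_farDictator, shift_eq_add, ← hH]
  -- reindex `j ↦ j + H`
  have hre : ∑ j, bitVal (kline x j) * bitVal (x (j + H)) = ∑ i, bitVal (kline x (i - H)) * bitVal (x i) := by
    rw [← Equiv.sum_comp (Equiv.addRight H) (fun i => bitVal (kline x (i - H)) * bitVal (x i))]
    refine sum_congr rfl fun j _ => ?_
    simp [Equiv.addRight]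
  rw [hre]
  -- split along `J_i`
  have hsplit : ∑ i, bitVal (kline x (i - H)) * bitVal (x i) =
      forcedBit H (kline x) + ∑ i, if kline x i = false then bitVal (kline x (i - H)) * bitVal (x i) else 0 := by
    unfold forcedBit
    rw [← sum_add_distrib]
    refine sum_congr rfl fun i _ => ?_
    cases hJi : kline x i
    · simp
    · rw [if_pos rfl, if_neg (by decide), add_zero, apply_eq_of_kline hn x hodd i hJi]
  rw [hsplit]
  -- the coin part is the parity of the coins in `S(J)`
  have hcoin : (∑ i, if kline x i = false then bitVal (kline x (i - H)) * bitVal (x i) else 0) =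
      (((coinSet H (kline x)).filter fun i => x i = true).card : ZMod 2) := by
    rw [natCast_card_filter]
    unfold coinSet
    rw [sum_filter]
    refine sum_congr rfl fun i _ => ?_
    cases kline x i <;> cases kline x (i - H) <;> cases x i <;> simp [bitVal]
  rw [hcoin]

/-! ### The two exceptional events -/

/-- If `S(v) =` all particles then no two particles are at distance `h`. -/
theorem noPair_of_coinSet_eq [NeZero n] (H : Fin n) (v : Fin n → Bool)
    (hS : ∀ i, v i = false → v (i - H) = true) : ∀ p : Fin n, ¬ (v p = false ∧ v (p + H) = false) := by
  rintro p ⟨hp, hpH⟩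
  have := hS (p + H) hpH
  rw [add_sub_cancel_right] at this
  rw [this] at hp
  exact Bool.noConfusion hp

/-- If `S(v) = ∅` then the particle set is `+h`-closed (it is `−h`-closed, and `p ↦ p - H` is a bijection). -/
theorem closed_of_coinSet_empty [NeZero n] (H : Fin n) (v : Fin n → Bool)
    (hS : ∀ i, v i = false → v (i - H) = false) : ∀ p : Fin n, v p = false → v (p + H) = false := by
  set Z := univ.filter fun i : Fin n => v i = false with hZ
  have himg : Z.image (fun i => i - H) ⊆ Z := by
    intro q hq
    rw [mem_image] at hq
    obtain ⟨i, hi, rfl⟩ := hq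
    rw [hZ, mem_filter] at hi ⊢
    exact ⟨mem_univ _, hS i hi.2⟩
  have hcard : Z.card ≤ (Z.image fun i => i - H).card := by
    rw [card_image_of_injective _ (fun a b hab => sub_left_injective hab)]
  have heq : Z.image (fun i => i - H) = Z := eq_of_subset_of_card_le himg hcard
  intro p hp
  have hpZ : p ∈ Z := by rw [hZ, mem_filter]; exact ⟨mem_univ _, hp⟩
  rw [← heq, mem_image] at hpZ
  obtain ⟨q, hq, hqp⟩ := hpZ
  rw [hZ, mem_filter] at hq
  have : q = p + H := by rw [← hqp, sub_add_cancel]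
  rw [← this]; exact hq.2

/-! ### The assembly -/

/-- **`FarDictatorHalf3` from the two law-of-`J` lemmas** (Sketch19 §5 `farDictatorHalf3_of`). -/
theorem farDictatorHalf3_of (h1 : RareNoParticlePairAtDist) (h2 : RareShiftClosedParticles) :
    FarDictatorHalf3 := by
  intro ε hε
  obtain ⟨n₁, hn₁⟩ := h1 (ε / 2) (by linarith)
  obtain ⟨n₂, hn₂⟩ := h2 (ε / 2) (by linarith)
  refine ⟨max n₁ (max n₂ 3), fun n hn h hh2 hhn => ?_⟩
  have hn1' : n₁ ≤ n := le_trans (le_max_left _ _) hn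
  have hn2' : n₂ ≤ n := le_trans (le_trans (le_max_left _ _) (le_max_right _ _)) hn
  have hn3 : 3 ≤ n := le_trans (le_trans (le_max_right _ _) (le_max_right _ _)) hn
  haveI : NeZero n := ⟨by omega⟩
  have E1 := hn₁ n hn1' h hh2 hhn
  have E2 := hn₂ n hn2' h hh2 hhn
  set H : Fin n := (h : Fin n) with hH
  have hshift : ∀ p : Fin n, shift h p = p + H := fun p => shift_eq_add h p
  -- the sets, in `IsOdd` form
  set WIN := univ.filter fun x : Fin n → Bool => IsOdd x ∧ Rel x (farDictator h x) with hWIN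
  set B1 := univ.filter fun x : Fin n → Bool => IsOdd x ∧
    ∀ p : Fin n, ¬ (kline x p = false ∧ kline x (p + H) = false) with hB1
  set B2 := univ.filter fun x : Fin n → Bool => IsOdd x ∧
    ∀ p : Fin n, kline x p = false → kline x (p + H) = false with hB2
  set fib : (Fin n → Bool) → Finset (Fin n → Bool) :=
    fun v => univ.filter fun x : Fin n → Bool => IsOdd x ∧ kline x = v with hfib
  -- per fibre: `2·#(WIN ∩ fib v) ≤ #fib v + 2·#(B1 ∩ fib v) + 2·#(B2 ∩ fib v)`
  have hper : ∀ v : Fin n → Bool, 2 * (WIN.filter fun x => kline x = v).card ≤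
      (fib v).card + 2 * (B1.filter fun x => kline x = v).card + 2 * (B2.filter fun x => kline x = v).card := by
    intro v
    -- empty fibre?
    rcases (fib v).eq_empty_or_nonempty with hemp | ⟨x₀, hx₀⟩
    · have hW : (WIN.filter fun x => kline x = v) = ∅ := by
        rw [eq_empty_iff_forall_notMem]
        intro x hx
        simp only [hWIN, mem_filter, mem_univ, true_and] at hx
        have : x ∈ fib v := by simp only [hfib, mem_filter, mem_univ, true_and]; exact ⟨hx.1.1, hx.2⟩
        rw [hemp] at this; simp at this
      rw [hW, card_empty]; omega
    simp only [hfib, mem_filter, mem_univ, true_and] at hx₀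
    obtain ⟨ho₀, hk₀⟩ := hx₀
    have hvc : HardCore v := hk₀ ▸ kline_hardCore hn3 x₀ ho₀
    have hSsub : ∀ i ∈ coinSet H v, v i = false := fun i hi => by
      simp only [coinSet, mem_filter, mem_univ, true_and] at hi; exact hi.1
    by_cases hSall : ∃ i, v i = false ∧ i ∉ coinSet H v
    · by_cases hSne : (coinSet H v).Nonempty
      · -- the balanced case: WIN on the fibre = a fixed parity of the coins in `S`
        have hz : 0 < zeros v := by
          obtain ⟨i, hi, -⟩ := hSall; exact card_pos.2 ⟨i, mem_filter.2 ⟨mem_univ _, hi⟩⟩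
        have hcf := card_fibre hn3 v hvc hz
        have hcp := card_fibre_coinParity hn3 v hvc (coinSet H v) hSsub hSne hSall
        have hz2 : 2 ≤ zeros v := by
          obtain ⟨i₁, hi₁⟩ := hSne
          obtain ⟨i₂, hi₂, hi₂S⟩ := hSall
          have h12 : i₁ ≠ i₂ := fun e => hi₂S (e ▸ hi₁)
          calc 2 = ({i₁, i₂} : Finset (Fin n)).card := (card_pair h12).symm
            _ ≤ zeros v := card_le_card fun i hi => by
                rw [mem_insert, mem_singleton] at hi
                rw [mem_filter]
                rcases hi with rfl | rfl
                · exact ⟨mem_univ _, hSsub _ hi₁⟩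
                · exact ⟨mem_univ _, hi₂⟩
        -- `#(WIN ∩ fib v) = 2^{Z-2}` for both values of the forced bit
        have hWle : (WIN.filter fun x => kline x = v).card ≤ 2 ^ (zeros v - 2) := by
          -- the forced bit decides which parity class wins
          by_cases hc : forcedBit H v = 0
          · -- WIN ⟺ parity 1
            refine le_of_eq ((congrArg card ?_).trans hcp)
            ext x
            simp only [hWIN, mem_filter, mem_univ, true_and]
            constructor
            · rintro ⟨⟨ho, hr⟩, hk⟩
              rw [win_farDictator_iff hn3 h x ho, hk, ← hH, hc, zero_add] at hr
              refine ⟨ho, hk, ?_⟩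
              exact Nat.odd_iff.1 (ZMod.natCast_eq_one_iff_odd.1 hr)
            · rintro ⟨ho, hk, hpar⟩
              refine ⟨⟨ho, ?_⟩, hk⟩
              rw [win_farDictator_iff hn3 h x ho, hk, ← hH, hc, zero_add]
              exact ZMod.natCast_eq_one_iff_odd.2 (Nat.odd_iff.2 hpar)
          · -- WIN ⟺ parity 0: the complement inside the fibre
            have hc1 : forcedBit H v = 1 := by
              have : ∀ w : ZMod 2, w ≠ 0 → w = 1 := by decide
              exact this _ hc
            have hset : (WIN.filter fun x => kline x = v) =
                (fib v).filter fun x => ¬ (((coinSet H v).filter fun i => x i = true).card % 2 = 1) := by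
              ext x
              simp only [hWIN, hfib, mem_filter, mem_univ, true_and]
              constructor
              · rintro ⟨⟨ho, hr⟩, hk⟩
                rw [win_farDictator_iff hn3 h x ho, hk, ← hH, hc1] at hr
                refine ⟨⟨ho, hk⟩, fun hpar => ?_⟩
                have h1' : ((((coinSet H v).filter fun i => x i = true).card : ℕ) : ZMod 2) = 1 :=
                  ZMod.natCast_eq_one_iff_odd.2 (Nat.odd_iff.2 hpar)
                rw [h1'] at hr; exact absurd hr (by decide)
              · rintro ⟨⟨ho, hk⟩, hpar⟩
                refine ⟨⟨ho, ?_⟩, hk⟩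
                rw [win_farDictator_iff hn3 h x ho, hk, ← hH, hc1]
                have h0 : ((((coinSet H v).filter fun i => x i = true).card : ℕ) : ZMod 2) = 0 := by
                  rw [ZMod.natCast_eq_zero_iff_even, Nat.even_iff]; omega
                rw [h0]; decide
            have hsplit := Finset.card_filter_add_card_filter_not (s := fib v)
              (fun x => ((coinSet H v).filter fun i => x i = true).card % 2 = 1)
            have hpos : ((fib v).filter fun x => ((coinSet H v).filter fun i => x i = true).card % 2 = 1).card =
                2 ^ (zeros v - 2) := by
              rw [← hcp, hfib]
              congr 1; ext x; simp only [mem_filter, mem_univ, true_and, and_assoc]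
            rw [hset]
            rw [hcf] at hsplit
            obtain ⟨z, hz'⟩ : ∃ z, zeros v = z + 2 := ⟨zeros v - 2, by omega⟩
            rw [hz', show z + 2 - 1 = z + 1 from rfl, pow_succ] at hsplit
            rw [hz', Nat.add_sub_cancel] at hpos ⊢
            omega
        rw [hcf]
        obtain ⟨z, hz'⟩ : ∃ z, zeros v = z + 2 := ⟨zeros v - 2, by omega⟩
        rw [hz', Nat.add_sub_cancel] at hWle
        rw [hz', show z + 2 - 1 = z + 1 from rfl, pow_succ]
        omega
      · -- `S = ∅`: the fibre lies in `B2`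
        have hS0 : ∀ i, v i = false → v (i - H) = false := by
          intro i hi
          by_contra hc
          rw [Bool.not_eq_false] at hc
          exact hSne ⟨i, by simp only [coinSet, mem_filter, mem_univ, true_and]; exact ⟨hi, hc⟩⟩
        have hcl := closed_of_coinSet_empty H v hS0
        have hsub : (WIN.filter fun x => kline x = v) ⊆ B2.filter fun x => kline x = v := by
          intro x hx
          simp only [hWIN, hB2, mem_filter, mem_univ, true_and] at hx ⊢
          refine ⟨⟨hx.1.1, fun p hp => ?_⟩, hx.2⟩
          rw [hx.2] at hp ⊢; exact hcl p hp
        have := card_le_card hsub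
        omega
    · -- `S =` all particles: the fibre lies in `B1`
      push Not at hSall
      have hall : ∀ i, v i = false → v (i - H) = true := fun i hi => by
        have := hSall i hi
        simp only [coinSet, mem_filter, mem_univ, true_and] at this
        exact this.2
      have hnp := noPair_of_coinSet_eq H v hall
      have hsub : (WIN.filter fun x => kline x = v) ⊆ B1.filter fun x => kline x = v := by
        intro x hx
        simp only [hWIN, hB1, mem_filter, mem_univ, true_and] at hx ⊢
        refine ⟨⟨hx.1.1, fun p => ?_⟩, hx.2⟩
        rw [hx.2]; exact hnp p
      have := card_le_card hsub
      omega
  -- sum over the fibres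
  have hfw : ∀ (T : Finset (Fin n → Bool)), T.card = ∑ v, (T.filter fun x => kline x = v).card :=
    fun T => card_eq_sum_card_fiberwise (f := kline) (t := univ) (by intro x _; exact mem_univ _)
  have hsumfib : ∑ v : Fin n → Bool, (fib v).card = 2 ^ (n - 1) := by
    rw [← card_isOdd (by omega : 1 ≤ n), hfw (univ.filter fun x : Fin n → Bool => IsOdd x)]
    refine sum_congr rfl fun v _ => ?_
    rw [hfib]
    congr 1; ext x; simp only [mem_filter, mem_univ, true_and]
  have hmain : 2 * WIN.card ≤ 2 ^ (n - 1) + 2 * B1.card + 2 * B2.card := by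
    rw [hfw WIN, hfw B1, hfw B2, ← hsumfib, mul_sum, mul_sum, mul_sum, ← sum_add_distrib, ← sum_add_distrib]
    exact sum_le_sum fun v _ => hper v
  -- compare with the statement's sets
  have hB1le : (B1.card : ℝ) ≤ ε / 2 * (2 : ℝ) ^ (n - 1) := by
    refine le_trans ?_ E1
    refine (Nat.cast_le (α := ℝ)).2 (card_le_card fun x hx => ?_)
    · simp only [hB1, mem_filter, mem_univ, true_and] at hx
      simp only [mem_filter, mem_univ, true_and]
      refine ⟨(isOdd_iff_oddZeros x).1 hx.1, fun p => ?_⟩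
      rw [hshift]; exact hx.2 p
  have hB2le : (B2.card : ℝ) ≤ ε / 2 * (2 : ℝ) ^ (n - 1) := by
    refine le_trans ?_ E2
    refine (Nat.cast_le (α := ℝ)).2 (card_le_card fun x hx => ?_)
    · simp only [hB2, mem_filter, mem_univ, true_and] at hx
      simp only [mem_filter, mem_univ, true_and]
      refine ⟨(isOdd_iff_oddZeros x).1 hx.1, fun p hp => ?_⟩
      rw [hshift]; exact hx.2 p hp
  have hWIN' : (WIN.card : ℝ) ≤ (1 / 2 + ε) * (2 : ℝ) ^ (n - 1) := by
    have hm : (2 * (WIN.card : ℝ)) ≤ (2 : ℝ) ^ (n - 1) + 2 * B1.card + 2 * B2.card := by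
      have := (Nat.cast_le (α := ℝ)).2 hmain
      rw [Nat.cast_add, Nat.cast_add, Nat.cast_mul, Nat.cast_mul, Nat.cast_mul, Nat.cast_pow,
        Nat.cast_ofNat] at this
      exact this
    linarith
  refine le_trans ?_ hWIN'
  refine (Nat.cast_le (α := ℝ)).2 (card_le_card fun x hx => ?_)
  simp only [mem_filter, mem_univ, true_and] at hx
  rw [hWIN, mem_filter]
  exact ⟨mem_univ _, (isOdd_iff_oddZeros x).2 hx.1, hx.2⟩

end Summit.QuantumAdvantage.AdviceFreeQNC0.Fib19

end
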